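import Summits.MatrixMultiplication.OmegaCensus.VertexCountingCore
import HarnessLib

/-!
# Arithmetic of the eight vertex constraints, III: total slack `≤ 16` forces two balanced pairs once `V ≥ 31`

ω-census `pub-omega`, family (b3), seat pub-omega-group gen 15.  Framing: lottery ticket; floor = certified bounds/negative
ranges.  VALUE: an arithmetic lemma feeding kernel theorems about the group-theoretic method (TPP capacity of dihedral-like
groups); NOT progress on ω.

Setting of `VertexCountingCore.lean`: non-negative integers `s₀, s₁, t₀, t₁, u₀, u₁` (coset part sizes of a TPP triple of a
dihedral-like group), volume `V = (s₀+s₁)(t₀+t₁)(u₀+u₁)`, a modulus `N` with the eight vertex constraints, and the total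
slack `D = 8N − 3V ≥ 0`.  `VertexCountingGap12.lean` proved: `V ≥ 127` and `D ≤ 31` force two balanced pairs
(`two_balanced_of_vertex_bounds31`), the threshold `127` being sharp for `D ≤ 31`.

**Theorem (`two_balanced_of_vertex_bounds16`).** If `V ≥ 31` and `D ≤ 16` then two of the three part pairs are balanced
(`s₀ = s₁ ∧ t₀ = t₁`, or `s₀ = s₁ ∧ u₀ = u₁`, or `t₀ = t₁ ∧ u₀ = u₁`).

The threshold is sharp: `(1,1 | 1,2 | 2,3)` (one balanced pair) satisfies all eight constraints with `N = 13`, `V = 30`,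
`D = 14`.  The point of the lower threshold: the dicyclic packing law `3V + 16 = 8|A|` has slack EXACTLY `16`, so the shape
classification behind `no_dicyclic_law_of_two_group_quot` (gen 12, stated for `|A| ≥ 50` because of the threshold `127`)
becomes available from `V ≥ 31`, i.e. for every `|A| ≥ 14` — in particular at `|A| = 32` (`V = 80`), the order-`64`
dicyclic-type groups (`DicyclicLaw32.lean`).

**Proof.** As in `VertexCountingGap12.lean`, with both the one-balanced and the unbalanced case closed by finite checks:
* one balanced pair (`s₀ = s₁ = s`, `t₁ = t₀+a+1`, `u₁ = u₀+b+1`): the constraint omitting `t₀u₀` reads `2sE ≤ D ≤ 16`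
  with `E = 2t₀(b+1) + 2u₀(a+1) + (a+1)(b+1) ≥ 1`, so `s ≤ 8`, `t₀, u₀ ≤ 3`, `a, b ≤ 7`, and the `8 192`-point check
  `one_balanced_fc16` gives `V ≤ 30`;
* no balanced pair (wlog `s₁ < s₀`, `t₁ < t₀`, `u₁ < u₀`): `3αβγ ≤ 16`, `Sβγ, Tαγ, Uαβ ≤ 16` bound the box and the
  `1 337`-point check `vertex_fc16` gives `V ≤ 30`.
-/

namespace Summit.MatrixMultiplication.OmegaCensus

/-! ## One balanced pair: `V ≤ 30` -/

/-- The finite check for the one-balanced case, normalised to `s₀ = s₁ = s' + 1`, `t₁ = t₀ + a + 1`, `u₁ = u₀ + b + 1`: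
for `s' < 8`, `t₀, u₀ < 4`, `a, b < 8`, the inequality `8·(vertex sum omitting t₀u₀) ≤ 3V + 16` implies `V ≤ 30`
(`8 192` evaluations). [folklore] -/
theorem one_balanced_fc16 :
    ((List.range 8).all fun s' => (List.range 4).all fun t₀ => (List.range 4).all fun u₀ =>
      (List.range 8).all fun a => (List.range 8).all fun b =>
        decide (
          8 * ((s' + 1) * (t₀ + a + 1) * (u₀ + b + 1) + (s' + 1) * t₀ * (u₀ + b + 1) +
              (s' + 1) * (t₀ + a + 1) * u₀) ≤
            3 * ((s' + 1 + (s' + 1)) * (t₀ + (t₀ + a + 1)) * (u₀ + (u₀ + b + 1))) + 16 →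
          (s' + 1 + (s' + 1)) * (t₀ + (t₀ + a + 1)) * (u₀ + (u₀ + b + 1)) ≤ 30)) = true := by
  decide

/-- One balanced pair, core case (`s₀ = s₁ = s`, `t₀ < t₁`, `u₀ < u₁`): the vertex constraint omitting `t₀u₀` together
with `8N ≤ 3V + 16` forces `V ≤ 30`. [folklore] -/
theorem one_balanced_core16 (N s t₀ t₁ u₀ u₁ : ℕ) (ht : t₀ < t₁) (hu : u₀ < u₁)
    (hL : s * t₁ * u₁ + s * t₀ * u₁ + s * t₁ * u₀ ≤ N)
    (hD : 8 * N ≤ 3 * ((s + s) * (t₀ + t₁) * (u₀ + u₁)) + 16) :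
    (s + s) * (t₀ + t₁) * (u₀ + u₁) ≤ 30 := by
  obtain ⟨a, rfl⟩ : ∃ a, t₁ = t₀ + a + 1 := ⟨t₁ - t₀ - 1, by omega⟩
  obtain ⟨b, rfl⟩ : ∃ b, u₁ = u₀ + b + 1 := ⟨u₁ - u₀ - 1, by omega⟩
  have h1 : 8 * (s * (t₀ + a + 1) * (u₀ + b + 1) + s * t₀ * (u₀ + b + 1) + s * (t₀ + a + 1) * u₀) ≤
      3 * ((s + s) * (t₀ + (t₀ + a + 1)) * (u₀ + (u₀ + b + 1))) + 16 := le_trans (Nat.mul_le_mul_left 8 hL) hD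
  -- the slack inequality `2 s E ≤ 16`, `E = 2t₀(b+1) + 2u₀(a+1) + (a+1)(b+1)`
  have h2 : 2 * (s * (2 * (t₀ * b) + 2 * t₀ + 2 * (a * u₀) + 2 * u₀ + a * b + a + b + 1)) ≤ 16 := by
    nlinarith [h1]
  have h3 : s * (2 * (t₀ * b) + 2 * t₀ + 2 * (a * u₀) + 2 * u₀ + a * b + a + b + 1) ≤ 8 := by omega
  rcases Nat.eq_zero_or_pos s with rfl | hs
  · simp
  -- bounds for the finite check
  have hE : 2 * t₀ + 2 * u₀ + a + b + 1 ≤ 2 * (t₀ * b) + 2 * t₀ + 2 * (a * u₀) + 2 * u₀ + a * b + a + b + 1 := by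
    have h0 : 0 ≤ 2 * (t₀ * b) + 2 * (a * u₀) + a * b := Nat.zero_le _
    omega
  have h4 : s * (2 * t₀ + 2 * u₀ + a + b + 1) ≤ 8 := le_trans (Nat.mul_le_mul_left s hE) h3
  have h5 : 2 * t₀ + 2 * u₀ + a + b + 1 ≤ 8 := le_trans (Nat.le_mul_of_pos_left _ hs) h4
  have h6 : s ≤ 8 := le_trans (Nat.le_mul_of_pos_right _ (by omega)) h4
  obtain ⟨s', rfl⟩ : ∃ s', s = s' + 1 := ⟨s - 1, by omega⟩
  have hs' : s' < 8 := by omega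
  have ht₀ : t₀ < 4 := by omega
  have hu₀ : u₀ < 4 := by omega
  have ha : a < 8 := by omega
  have hb : b < 8 := by omega
  have key := one_balanced_fc16
  simp only [List.all_eq_true, List.mem_range, decide_eq_true_iff] at key
  exact key s' hs' t₀ ht₀ u₀ hu₀ a ha b hb h1

/-- One balanced pair (`s₀ = s₁ = s`, `t₀ ≠ t₁`, `u₀ ≠ u₁`), all four "omit one product `t_j u_k`" vertex constraints
available: `8N ≤ 3V + 16` forces `V ≤ 30`. [folklore] -/
theorem one_balanced_le16 (N s t₀ t₁ u₀ u₁ : ℕ) (ht : t₀ ≠ t₁) (hu : u₀ ≠ u₁)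
    (h00 : s * t₁ * u₁ + s * t₀ * u₁ + s * t₁ * u₀ ≤ N) (h11 : s * t₀ * u₀ + s * t₁ * u₀ + s * t₀ * u₁ ≤ N)
    (h01 : s * t₀ * u₀ + s * t₁ * u₀ + s * t₁ * u₁ ≤ N) (h10 : s * t₀ * u₀ + s * t₀ * u₁ + s * t₁ * u₁ ≤ N)
    (hD : 8 * N ≤ 3 * ((s + s) * (t₀ + t₁) * (u₀ + u₁)) + 16) :
    (s + s) * (t₀ + t₁) * (u₀ + u₁) ≤ 30 := by
  rcases Nat.lt_or_gt_of_ne ht with ht' | ht' <;> rcases Nat.lt_or_gt_of_ne hu with hu' | hu'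
  · exact one_balanced_core16 N s t₀ t₁ u₀ u₁ ht' hu' h00 hD
  · -- `t₀ < t₁`, `u₁ < u₀`: omit `t₀ u₁`
    have key := one_balanced_core16 N s t₀ t₁ u₁ u₀ ht' hu' (by linarith) (by linarith)
    linarith
  · -- `t₁ < t₀`, `u₀ < u₁`: omit `t₁ u₀`
    have key := one_balanced_core16 N s t₁ t₀ u₀ u₁ ht' hu' (by linarith) (by linarith)
    linarith
  · -- `t₁ < t₀`, `u₁ < u₀`: omit `t₁ u₁`
    have key := one_balanced_core16 N s t₁ t₀ u₁ u₀ ht' hu' (by linarith) (by linarith)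
    linarith

/-! ## No balanced pair: a finite check -/

/-- The finite check for the all-unbalanced case, normalised to `s₀ = s₁+a+1`, `t₀ = t₁+b+1`, `u₀ = u₁+c+1`: for all
`(a,b,c,s₁,t₁,u₁)` in the box `(a+1)(b+1)(c+1) ≤ 5`, `(2s₁+a+1)(b+1)(c+1) ≤ 16`, `(2t₁+b+1)(a+1)(c+1) ≤ 16`,
`(2u₁+c+1)(a+1)(b+1) ≤ 16` (as `List.range` bounds), the eight inequalities `8·(vertex sum) ≤ 3V + 16` imply `V ≤ 30`
(`1 337` evaluations; in fact `V ≤ 27`). [folklore] -/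
theorem vertex_fc16 :
    ((List.range 5).all fun a => (List.range (5 / (a + 1))).all fun b =>
      (List.range (5 / ((a + 1) * (b + 1)))).all fun c =>
      (List.range ((16 / ((b + 1) * (c + 1)) - (a + 1)) / 2 + 1)).all fun s₁ =>
      (List.range ((16 / ((a + 1) * (c + 1)) - (b + 1)) / 2 + 1)).all fun t₁ =>
      (List.range ((16 / ((a + 1) * (b + 1)) - (c + 1)) / 2 + 1)).all fun u₁ =>
        decide (
          8 * (s₁ * (t₁ + b + 1) * (u₁ + c + 1) + (s₁ + a + 1) * t₁ * (u₁ + c + 1) + (s₁ + a + 1) * (t₁ + b + 1) * u₁) ≤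
            3 * ((s₁ + a + 1 + s₁) * (t₁ + b + 1 + t₁) * (u₁ + c + 1 + u₁)) + 16 →
          8 * ((s₁ + a + 1) * t₁ * u₁ + s₁ * (t₁ + b + 1) * u₁ + s₁ * t₁ * (u₁ + c + 1)) ≤
            3 * ((s₁ + a + 1 + s₁) * (t₁ + b + 1 + t₁) * (u₁ + c + 1 + u₁)) + 16 →
          8 * ((s₁ + a + 1) * (t₁ + b + 1) * (u₁ + c + 1) + s₁ * t₁ * (u₁ + c + 1) + s₁ * (t₁ + b + 1) * u₁) ≤
            3 * ((s₁ + a + 1 + s₁) * (t₁ + b + 1 + t₁) * (u₁ + c + 1 + u₁)) + 16 →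
          8 * (s₁ * t₁ * u₁ + (s₁ + a + 1) * (t₁ + b + 1) * u₁ + (s₁ + a + 1) * t₁ * (u₁ + c + 1)) ≤
            3 * ((s₁ + a + 1 + s₁) * (t₁ + b + 1 + t₁) * (u₁ + c + 1 + u₁)) + 16 →
          8 * (s₁ * t₁ * (u₁ + c + 1) + (s₁ + a + 1) * (t₁ + b + 1) * (u₁ + c + 1) + (s₁ + a + 1) * t₁ * u₁) ≤
            3 * ((s₁ + a + 1 + s₁) * (t₁ + b + 1 + t₁) * (u₁ + c + 1 + u₁)) + 16 →
          8 * ((s₁ + a + 1) * (t₁ + b + 1) * u₁ + s₁ * t₁ * u₁ + s₁ * (t₁ + b + 1) * (u₁ + c + 1)) ≤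
            3 * ((s₁ + a + 1 + s₁) * (t₁ + b + 1 + t₁) * (u₁ + c + 1 + u₁)) + 16 →
          8 * (s₁ * (t₁ + b + 1) * u₁ + (s₁ + a + 1) * t₁ * u₁ + (s₁ + a + 1) * (t₁ + b + 1) * (u₁ + c + 1)) ≤
            3 * ((s₁ + a + 1 + s₁) * (t₁ + b + 1 + t₁) * (u₁ + c + 1 + u₁)) + 16 →
          8 * ((s₁ + a + 1) * t₁ * (u₁ + c + 1) + s₁ * (t₁ + b + 1) * (u₁ + c + 1) + s₁ * t₁ * u₁) ≤
            3 * ((s₁ + a + 1 + s₁) * (t₁ + b + 1 + t₁) * (u₁ + c + 1 + u₁)) + 16 →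
          (s₁ + a + 1 + s₁) * (t₁ + b + 1 + t₁) * (u₁ + c + 1 + u₁) ≤ 30)) = true := by
  decide

/-- The all-unbalanced case, normalised (`s₁ < s₀`, `t₁ < t₀`, `u₁ < u₀`): `8N ≤ 3V + 16` forces `V ≤ 30`.  The four odd
vertices give `3(s₀−s₁)(t₀−t₁)(u₀−u₁) ≤ 16`, the antipodal pairs give `(s₀+s₁)(t₀−t₁)(u₀−u₁) ≤ 16` and its two
analogues, and `vertex_fc16` applies. [folklore] -/
theorem unbalanced_core16 (N s₀ s₁ t₀ t₁ u₀ u₁ : ℕ) (hs : s₁ < s₀) (ht : t₁ < t₀) (hu : u₁ < u₀)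
    (h000 : s₁ * t₀ * u₀ + s₀ * t₁ * u₀ + s₀ * t₀ * u₁ ≤ N) (h111 : s₀ * t₁ * u₁ + s₁ * t₀ * u₁ + s₁ * t₁ * u₀ ≤ N)
    (h100 : s₀ * t₀ * u₀ + s₁ * t₁ * u₀ + s₁ * t₀ * u₁ ≤ N) (h011 : s₁ * t₁ * u₁ + s₀ * t₀ * u₁ + s₀ * t₁ * u₀ ≤ N)
    (h010 : s₁ * t₁ * u₀ + s₀ * t₀ * u₀ + s₀ * t₁ * u₁ ≤ N) (h101 : s₀ * t₀ * u₁ + s₁ * t₁ * u₁ + s₁ * t₀ * u₀ ≤ N)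
    (h001 : s₁ * t₀ * u₁ + s₀ * t₁ * u₁ + s₀ * t₀ * u₀ ≤ N) (h110 : s₀ * t₁ * u₀ + s₁ * t₀ * u₀ + s₁ * t₁ * u₁ ≤ N)
    (hD : 8 * N ≤ 3 * ((s₀ + s₁) * (t₀ + t₁) * (u₀ + u₁)) + 16) :
    (s₀ + s₁) * (t₀ + t₁) * (u₀ + u₁) ≤ 30 := by
  obtain ⟨a, rfl⟩ : ∃ a, s₀ = s₁ + a + 1 := ⟨s₀ - s₁ - 1, by omega⟩
  obtain ⟨b, rfl⟩ : ∃ b, t₀ = t₁ + b + 1 := ⟨t₀ - t₁ - 1, by omega⟩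
  obtain ⟨c, rfl⟩ : ∃ c, u₀ = u₁ + c + 1 := ⟨u₀ - u₁ - 1, by omega⟩
  -- `3αβγ ≤ D` (odd vertices) and `Sβγ, Tαγ, Uαβ ≤ D` (antipodal pairs)
  have hO : 3 * ((a + 1) * (b + 1) * (c + 1)) ≤ 16 := by linarith
  have hX : (s₁ + a + 1 + s₁) * ((b + 1) * (c + 1)) ≤ 16 := by linarith
  have hY : (t₁ + b + 1 + t₁) * ((a + 1) * (c + 1)) ≤ 16 := by linarith
  have hZ : (u₁ + c + 1 + u₁) * ((a + 1) * (b + 1)) ≤ 16 := by linarith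
  -- loop bounds
  have hP : (a + 1) * (b + 1) * (c + 1) ≤ 5 := by omega
  have hab : (a + 1) * (b + 1) ≤ 5 := le_trans (Nat.le_mul_of_pos_right _ (by omega)) hP
  have ha : a < 5 := by
    have := Nat.le_mul_of_pos_right (a + 1) (show 0 < b + 1 by omega)
    omega
  have hb : b < 5 / (a + 1) := by
    have : b + 1 ≤ 5 / (a + 1) := (Nat.le_div_iff_mul_le (by omega)).2 (by rw [mul_comm]; exact hab)
    omega
  have hc : c < 5 / ((a + 1) * (b + 1)) := by
    have : c + 1 ≤ 5 / ((a + 1) * (b + 1)) := (Nat.le_div_iff_mul_le (by positivity)).2 (by rw [mul_comm]; exact hP)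
    omega
  have hs₁ : s₁ < (16 / ((b + 1) * (c + 1)) - (a + 1)) / 2 + 1 := by
    have : s₁ + a + 1 + s₁ ≤ 16 / ((b + 1) * (c + 1)) := (Nat.le_div_iff_mul_le (by positivity)).2 hX
    omega
  have ht₁ : t₁ < (16 / ((a + 1) * (c + 1)) - (b + 1)) / 2 + 1 := by
    have : t₁ + b + 1 + t₁ ≤ 16 / ((a + 1) * (c + 1)) := (Nat.le_div_iff_mul_le (by positivity)).2 hY
    omega
  have hu₁ : u₁ < (16 / ((a + 1) * (b + 1)) - (c + 1)) / 2 + 1 := by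
    have : u₁ + c + 1 + u₁ ≤ 16 / ((a + 1) * (b + 1)) := (Nat.le_div_iff_mul_le (by positivity)).2 hZ
    omega
  have key := vertex_fc16
  simp only [List.all_eq_true, List.mem_range, decide_eq_true_iff] at key
  exact key a ha b hb c hc s₁ hs₁ t₁ ht₁ u₁ hu₁ (by linarith) (by linarith) (by linarith) (by linarith) (by linarith)
    (by linarith) (by linarith) (by linarith)

/-- The all-unbalanced case (`s₀ ≠ s₁`, `t₀ ≠ t₁`, `u₀ ≠ u₁`): `8N ≤ 3V + 16` forces `V ≤ 30` (eight sign cases of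
`unbalanced_core16`). [folklore] -/
theorem unbalanced_le16 (N s₀ s₁ t₀ t₁ u₀ u₁ : ℕ) (hs : s₀ ≠ s₁) (ht : t₀ ≠ t₁) (hu : u₀ ≠ u₁)
    (h000 : s₁ * t₀ * u₀ + s₀ * t₁ * u₀ + s₀ * t₀ * u₁ ≤ N) (h111 : s₀ * t₁ * u₁ + s₁ * t₀ * u₁ + s₁ * t₁ * u₀ ≤ N)
    (h100 : s₀ * t₀ * u₀ + s₁ * t₁ * u₀ + s₁ * t₀ * u₁ ≤ N) (h011 : s₁ * t₁ * u₁ + s₀ * t₀ * u₁ + s₀ * t₁ * u₀ ≤ N)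
    (h010 : s₁ * t₁ * u₀ + s₀ * t₀ * u₀ + s₀ * t₁ * u₁ ≤ N) (h101 : s₀ * t₀ * u₁ + s₁ * t₁ * u₁ + s₁ * t₀ * u₀ ≤ N)
    (h001 : s₁ * t₀ * u₁ + s₀ * t₁ * u₁ + s₀ * t₀ * u₀ ≤ N) (h110 : s₀ * t₁ * u₀ + s₁ * t₀ * u₀ + s₁ * t₁ * u₁ ≤ N)
    (hD : 8 * N ≤ 3 * ((s₀ + s₁) * (t₀ + t₁) * (u₀ + u₁)) + 16) :
    (s₀ + s₁) * (t₀ + t₁) * (u₀ + u₁) ≤ 30 := by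
  rcases Nat.lt_or_gt_of_ne hs with hs' | hs' <;> rcases Nat.lt_or_gt_of_ne ht with ht' | ht' <;>
    rcases Nat.lt_or_gt_of_ne hu with hu' | hu'
  · have key := unbalanced_core16 N s₁ s₀ t₁ t₀ u₁ u₀ hs' ht' hu' (by linarith) (by linarith) (by linarith)
      (by linarith) (by linarith) (by linarith) (by linarith) (by linarith) (by linarith)
    linarith
  · have key := unbalanced_core16 N s₁ s₀ t₁ t₀ u₀ u₁ hs' ht' hu' (by linarith) (by linarith) (by linarith)
      (by linarith) (by linarith) (by linarith) (by linarith) (by linarith) (by linarith)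
    linarith
  · have key := unbalanced_core16 N s₁ s₀ t₀ t₁ u₁ u₀ hs' ht' hu' (by linarith) (by linarith) (by linarith)
      (by linarith) (by linarith) (by linarith) (by linarith) (by linarith) (by linarith)
    linarith
  · have key := unbalanced_core16 N s₁ s₀ t₀ t₁ u₀ u₁ hs' ht' hu' (by linarith) (by linarith) (by linarith)
      (by linarith) (by linarith) (by linarith) (by linarith) (by linarith) (by linarith)
    linarith
  · have key := unbalanced_core16 N s₀ s₁ t₁ t₀ u₁ u₀ hs' ht' hu' (by linarith) (by linarith) (by linarith)
      (by linarith) (by linarith) (by linarith) (by linarith) (by linarith) (by linarith)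
    linarith
  · have key := unbalanced_core16 N s₀ s₁ t₁ t₀ u₀ u₁ hs' ht' hu' (by linarith) (by linarith) (by linarith)
      (by linarith) (by linarith) (by linarith) (by linarith) (by linarith) (by linarith)
    linarith
  · have key := unbalanced_core16 N s₀ s₁ t₀ t₁ u₁ u₀ hs' ht' hu' (by linarith) (by linarith) (by linarith)
      (by linarith) (by linarith) (by linarith) (by linarith) (by linarith) (by linarith)
    linarith
  · exact unbalanced_core16 N s₀ s₁ t₀ t₁ u₀ u₁ hs' ht' hu' h000 h111 h100 h011 h010 h101 h001 h110 hD

/-! ## Two balanced pairs -/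

/-- **Slack `≤ 16` forces two balanced pairs once `V ≥ 31`.** If the eight vertex constraints hold, `V ≥ 31` and
`8N ≤ 3V + 16`, then two of the three part pairs are balanced. [folklore] -/
theorem two_balanced_of_vertex_bounds16 (N s₀ s₁ t₀ t₁ u₀ u₁ : ℕ)
    (h000 : s₁ * t₀ * u₀ + s₀ * t₁ * u₀ + s₀ * t₀ * u₁ ≤ N) (h111 : s₀ * t₁ * u₁ + s₁ * t₀ * u₁ + s₁ * t₁ * u₀ ≤ N)
    (h100 : s₀ * t₀ * u₀ + s₁ * t₁ * u₀ + s₁ * t₀ * u₁ ≤ N) (h011 : s₁ * t₁ * u₁ + s₀ * t₀ * u₁ + s₀ * t₁ * u₀ ≤ N)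
    (h010 : s₁ * t₁ * u₀ + s₀ * t₀ * u₀ + s₀ * t₁ * u₁ ≤ N) (h101 : s₀ * t₀ * u₁ + s₁ * t₁ * u₁ + s₁ * t₀ * u₀ ≤ N)
    (h001 : s₁ * t₀ * u₁ + s₀ * t₁ * u₁ + s₀ * t₀ * u₀ ≤ N) (h110 : s₀ * t₁ * u₀ + s₁ * t₀ * u₀ + s₁ * t₁ * u₁ ≤ N)
    (hV : 31 ≤ (s₀ + s₁) * (t₀ + t₁) * (u₀ + u₁)) (hD : 8 * N ≤ 3 * ((s₀ + s₁) * (t₀ + t₁) * (u₀ + u₁)) + 16) :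
    (s₀ = s₁ ∧ t₀ = t₁) ∨ (s₀ = s₁ ∧ u₀ = u₁) ∨ (t₀ = t₁ ∧ u₀ = u₁) := by
  by_cases hs : s₀ = s₁ <;> by_cases ht : t₀ = t₁ <;> by_cases hu : u₀ = u₁
  · exact Or.inl ⟨hs, ht⟩
  · exact Or.inl ⟨hs, ht⟩
  · exact Or.inr (Or.inl ⟨hs, hu⟩)
  · -- `s` balanced only
    exfalso; subst hs
    have key := one_balanced_le16 N s₀ t₀ t₁ u₀ u₁ ht hu (by linarith) (by linarith) (by linarith) (by linarith) hD
    omega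
  · exact Or.inr (Or.inr ⟨ht, hu⟩)
  · -- `t` balanced only: roles `(t, u, s)`
    exfalso; subst ht
    have key := one_balanced_le16 N t₀ u₀ u₁ s₀ s₁ hu hs (by linarith) (by linarith) (by linarith) (by linarith)
      (by linarith)
    linarith
  · -- `u` balanced only: roles `(u, s, t)`
    exfalso; subst hu
    have key := one_balanced_le16 N u₀ s₀ s₁ t₀ t₁ hs ht (by linarith) (by linarith) (by linarith) (by linarith)
      (by linarith)
    linarith
  · exfalso
    have key := unbalanced_le16 N s₀ s₁ t₀ t₁ u₀ u₁ hs ht hu h000 h111 h100 h011 h010 h101 h001 h110 hD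
    omega

/-- **Dicyclic-law form.** If the eight vertex constraints hold with modulus `N ≥ 14` and `3V + 16 = 8N` (the dicyclic
packing law), then two of the three part pairs are balanced. [folklore] -/
theorem two_balanced_of_dicyclic_law (N s₀ s₁ t₀ t₁ u₀ u₁ : ℕ)
    (h000 : s₁ * t₀ * u₀ + s₀ * t₁ * u₀ + s₀ * t₀ * u₁ ≤ N) (h111 : s₀ * t₁ * u₁ + s₁ * t₀ * u₁ + s₁ * t₁ * u₀ ≤ N)
    (h100 : s₀ * t₀ * u₀ + s₁ * t₁ * u₀ + s₁ * t₀ * u₁ ≤ N) (h011 : s₁ * t₁ * u₁ + s₀ * t₀ * u₁ + s₀ * t₁ * u₀ ≤ N)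
    (h010 : s₁ * t₁ * u₀ + s₀ * t₀ * u₀ + s₀ * t₁ * u₁ ≤ N) (h101 : s₀ * t₀ * u₁ + s₁ * t₁ * u₁ + s₁ * t₀ * u₀ ≤ N)
    (h001 : s₁ * t₀ * u₁ + s₀ * t₁ * u₁ + s₀ * t₀ * u₀ ≤ N) (h110 : s₀ * t₁ * u₀ + s₁ * t₀ * u₀ + s₁ * t₁ * u₁ ≤ N)
    (hN : 14 ≤ N) (hlaw : 3 * ((s₀ + s₁) * (t₀ + t₁) * (u₀ + u₁)) + 16 = 8 * N) :
    (s₀ = s₁ ∧ t₀ = t₁) ∨ (s₀ = s₁ ∧ u₀ = u₁) ∨ (t₀ = t₁ ∧ u₀ = u₁) :=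
  two_balanced_of_vertex_bounds16 N s₀ s₁ t₀ t₁ u₀ u₁ h000 h111 h100 h011 h010 h101 h001 h110 (by omega) (by omega)

end Summit.MatrixMultiplication.OmegaCensus
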